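import Summits.QuantumFields.YangMills.Theorems.AlphaInputsT3ACFlatGaussianRows
import HarnessLib

/-!
# `AlphaInputsT3ACFlatGaussianCounts` — THE TWO VOLUME COUNTS OF ROW #12, ROWS #12∕#13 CLOSED FOR THE B0∣_{U=1} FIELDS, THE IDENTIFICATION WITH [B6] (2.155), AND THE
# RECORD's SIDE CONDITIONS (file 2b of the B0∣_{U=1} definer; continues ✓`AlphaInputsT3ACFlatGaussianRows`)

Cell `ym3-torus` (HUMAN RULING D-0037, YM ladder rung R3), width seat `ym3-torus-px8` g17 (★★OWNER ym3-torus-plan g36 WORD №106 + «DEFINER SETTLED: px8 g17»).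
`--supports stmt-QuantumFields-19936 --as helper`; THEOREMS ONLY (def-free), sorry-free, standard axioms; [folklore] counting over LANDED carriers BY NAME.  CREDIT NOTHING:
nothing of [Balaban1985UV3] is asserted; (α) data rows 0∕23 (the rows are closed for the DRAFTED fields, not for Bałaban's witness `𝔖_Bal`).

WHAT IS PROVED.  §4 THE TWO COUNTS: `badPts h` (box points whose block corner carries a big-block label outside `ΩblkOf h`) absorbs the non-Λ remaining variables
(`fst_mem_badPts_of_not_mem_lamBonds`) and the coarse bonds missing `Λ'₀(h)` (`fst_mem_badPts_of_face`); fibre counts ★`card_filter_label_le` (1-D: for `⌊Mk∕M₁⌋ ≤ N` and any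
residue, `#{t < Mk : ⌊L⌊t∕L⌋∕M₁⌋ ≡ r} ≤ 2(L+1)M₁`) and ★`card_fibre_le` (`≤ (2(L+1)M₁)³` per label); `card_badPts_le` + ✓`Carriers.card_compl_ΩblkOf_le_ZVol` ⟹
★`dimC_le_ZVol : dimC h ≤ 9(2(L+1)M₁)³·|Z_k(h)|` and ★`abs_J1_sub_JT_le_ZVol : |J1 h − JT| ≤ 27 log L·(2(L+1)M₁)³·|Z_k(h)|`.  §5 ★★`norm35_row_of_fields' (hT) (hZ) :
Norm35StepAsCited (piecesAC 𝔎 X 𝔖 k) (gamma2153 3 L) (aT L) (cvT L M₁) (cJT L M₁)` — row #12 CLOSED for the drafted fields with uniform constants (and #12 ∧ #13 for `withTZ 𝔖₀`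
by `rfl`).  §6 THE IDENTIFICATION: `posDef_blockDiagonal`; ★`gaussLog_QT_eq : gaussLog (QT S k) = 3·log (Zred L Mₖ (deltaPol Mₖ (L^k)))`, ★`logZT_draft_eq : JT + gaussLog QT =
3·log ((L³)^{|faces|}·Zred …)` — (62)'s number IS three times the logarithm of [B6] (2.155)'s evaluated left side at `J = 0`; ★`gaussLog_Q1_eq` likewise on `Λ` (✓`ZredLam_deltaPol`).
§7 the six numbers `(gamma2153 3 L, aT L, cvT, cJT, 9, 27 log L)` meet `Primitives.AlphaConsts`' side conditions (`c35_pos`∕`cT_pos`, `cv_nonneg`, `cJ35_nonneg`, `cn_nonneg`,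
`cJT_nonneg`) — the seed shape of ✓`AlphaInputsT3AC.exists_record_served_steps` (`…RecordStepConstants`).
HONEST SCOPE: (O‴χₛ)∕19936∕19200∕20520∕`YM3TorusSU2` NOT proved; rung R3 = SU(2) YM₃ on T³ — NOT d = 4, NOT infinite volume, NOT a mass gap, NOT Clay.  References:
T. Bałaban, CMP 102 (1985) 255–275 [Balaban1985UV3] ((35) p.265, (41) p.266, (61)–(63) pp.271–272); CMP 96 (1984) 223–250 [Balaban1984PropagatorsII] ((2.155) p.250).
-/

set_option autoImplicit false

noncomputable section

open MeasureTheory Finset Matrix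

namespace Summit.QuantumFields.YangMills.Theorems.AlphaInputsT3ACFlatGaussian

open Literature.MathematicalPhysics.QuantumFieldTheory.Balaban1983to89
open Literature.MathematicalPhysics.QuantumFieldTheory.Balaban1983to89.B6Lemma24Torus (pbox coarseSites faces mem_faces)
open Literature.MathematicalPhysics.QuantumFieldTheory.Balaban1983to89.B6Cov2156Torus (freeT elimT deltaPol gamma2153)
open Literature.MathematicalPhysics.QuantumFieldTheory.Balaban1983to89.B6Cov2156TorusSubset (elimTS lamFree lamFree_subset elimLam)
open Literature.MathematicalPhysics.QuantumFieldTheory.Balaban1983to89.B6LowerBound2153Torus (facesOf)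
open Literature.MathematicalPhysics.QuantumFieldTheory.Balaban1983to89.B10Eq35Norm (Norm35Model)
open Literature.MathematicalPhysics.QuantumFieldTheory.Balaban1985CMP102
open Literature.MathematicalPhysics.QuantumFieldTheory.Balaban1985CMP102.Setting
open Literature.MathematicalPhysics.QuantumFieldTheory.Balaban1985CMP102.Binders (Norm35StepAsCited LogZTExtensiveAsCited LogZTModel)
open Summit.QuantumFields.Balaban3D.Carriers
open Summit.QuantumFields.Balaban3D.Proofs.ScalesArithmetic (sites_eq_card P_d P_L P_m P_K)
open Summit.QuantumFields.Balaban3D.Proofs.Inputs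
open Summit.QuantumFields.Balaban3D.Proofs.TowerAC
open Summit.QuantumFields.Balaban3D.Proofs.SeriesAC
open Summit.QuantumFields.Balaban3D.Proofs.StandardAC
open Summit.QuantumFields.Balaban3D.Proofs.InputsAC
open Summit.QuantumFields.YangMills.Theorems.AlphaInputsT3ACNorm35LogZTRowsOfLeaves
  (logZTExtensiveAsCited_piecesAC_of_loewner piecesAC_logZT_eq piecesAC_logZ1_eq)
open Summit.QuantumFields.YangMills.Theorems.AlphaInputsT3ACFlatLoewnerLetters (loewner_letters_reindex_blockDiagonal)

/-! ## §4 The two volume counts (G1)(G2): bad block corners are paid for by `|Z_k(h)|` -/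

section Counts

variable {L : ℕ} (S : Scales L) (k : ℕ) (K₀ : CarrierConsts) (h : Hist S.P (k + 1))

/-- Membership in `Λ'₀(h)`. [folklore] -/
theorem mem_lamCoarse {y : Fin 3 → ℤ} :
    y ∈ lamCoarse S k K₀ h ↔ y ∈ coarseSites L (sideT S k) ∧ lab S k K₀ y ∈ ΩblkOf K₀.M₁ (rcolOf S K₀) (nblkOf S K₀ k) h :=
  Finset.mem_filter

/-- A box point whose corner is not in `Λ'₀(h)` is bad. [folklore] -/
theorem mem_badPts_of_corner_not_mem {z : Fin 3 → ℤ} (hz : z ∈ pbox (sideT S k))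
    (hc : B6Elimination.corner L z ∉ lamCoarse S k K₀ h) : z ∈ badPts S k K₀ h := by
  refine Finset.mem_filter.2 ⟨hz, fun hΩ => hc ?_⟩
  exact (mem_lamCoarse S k K₀ h).2 ⟨B6Lemma24Torus.corner_mem_coarseSites (one_le_L S) hz, hΩ⟩

/-- (G1, pointwise) A remaining torus variable that is NOT a Λ-bond sits over a bad point. [folklore] -/
theorem fst_mem_badPts_of_not_mem_lamBonds {p : B4.Idx (pbox (sideT S k)) 3} (hpf : p ∈ freeT L (sideT S k))
    (hp : p ∉ lamBonds S k K₀ h) : ((p.1 : ↥(pbox (sideT S k))) : Fin 3 → ℤ) ∈ badPts S k K₀ h := by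
  have hx : ((p.1 : ↥(pbox (sideT S k))) : Fin 3 → ℤ) ∈ pbox (sideT S k) := p.1.2
  refine mem_badPts_of_corner_not_mem S k K₀ h hx fun hc => hp ?_
  refine B6Cov2156TorusSubset.mem_lamFree.2 ⟨hpf, Or.inl ?_⟩
  show B6Elimination.corner L (B6Lemma24Torus.wrap (sideT S k) _) ∈ _
  rwa [B6Lemma24Torus.wrap_eq_self hx]

/-- (G2, pointwise) A coarse bond of the torus that does NOT meet `Λ'₀(h)` starts at a bad point. [folklore] -/
theorem fst_mem_badPts_of_face {c : (Fin 3 → ℤ) × Fin 3} (hc : c ∈ faces L (sideT S k))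
    (hc' : c ∉ facesOf L (sideT S k) (lamCoarse S k K₀ h)) : c.1 ∈ badPts S k K₀ h := by
  have hy : c.1 ∈ coarseSites L (sideT S k) := mem_faces.1 hc
  have hyb : c.1 ∈ pbox (sideT S k) := (B6Lemma24Torus.mem_coarseSites.1 hy).1
  refine mem_badPts_of_corner_not_mem S k K₀ h hyb fun hcm => hc' ?_
  refine (B6LowerBound2153Torus.mem_facesOf (sideT S k)).2 ⟨hc, Or.inl ?_⟩
  show B6Elimination.corner L (B6Lemma24Torus.wrap (sideT S k) _) ∈ _
  rwa [B6Lemma24Torus.wrap_eq_self hyb]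

/-- `(L·⌊z∕L⌋).toNat = L·(z.toNat∕L)` for `z ≥ 0`. [folklore] -/
theorem toNat_corner_coord (L : ℕ) {z : ℤ} (hz : 0 ≤ z) : ((L : ℤ) * (z / (L : ℤ))).toNat = L * (z.toNat / L) := by
  obtain ⟨n, rfl⟩ := Int.eq_ofNat_of_zero_le hz
  rw [Int.toNat_natCast, ← Int.natCast_div, ← Int.natCast_mul, Int.toNat_natCast]

/-- **THE 1-D FIBRE COUNT**: for `L, M₁ ≥ 1`, `N ≥ 1` with `⌊Mk∕M₁⌋ ≤ N`, and any residue `r` mod `N`, at most `2(L+1)M₁` of the coordinates `t < Mk` have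
`⌊L⌊t∕L⌋∕M₁⌋ ≡ r (mod N)` (`⌊L⌊t∕L⌋∕M₁⌋ ≤ N`, so it is `r` or `r + N`; each value is taken on an interval of length `(L+1)M₁`). [folklore] -/
theorem card_filter_label_le (L M₁ Mk N : ℕ) [NeZero N] (hL : 1 ≤ L) (hM₁ : 1 ≤ M₁) (hN : Mk / M₁ ≤ N) (r : ZMod N) :
    ((Finset.range Mk).filter fun t => ((L * (t / L) / M₁ : ℕ) : ZMod N) = r).card ≤ 2 * ((L + 1) * M₁) := by
  have hN1 : 1 ≤ N := Nat.one_le_iff_ne_zero.2 (NeZero.ne N)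
  -- the value `q₀` is taken on an interval of length `(L+1)·M₁`
  have hfib : ∀ q₀ : ℕ, ((Finset.range Mk).filter fun t => L * (t / L) / M₁ = q₀) ⊆ Finset.Ico (q₀ * M₁) ((q₀ + L + 1) * M₁) := by
    intro q₀ t ht
    rw [Finset.mem_filter] at ht
    obtain ⟨-, hq⟩ := ht
    rw [Finset.mem_Ico]
    have h1 : L * (t / L) / M₁ * M₁ ≤ L * (t / L) := Nat.div_mul_le_self _ _
    have h2 : L * (t / L) ≤ t := Nat.mul_div_le t L
    have h3 : t < L * (t / L + 1) := Nat.lt_mul_div_succ t hL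
    have h4 : L * (t / L) < L * (t / L) / M₁ * M₁ + M₁ := Nat.lt_div_mul_add hM₁
    have h5 : L ≤ L * M₁ := Nat.le_mul_of_pos_right L hM₁
    rw [hq] at h1 h4
    constructor
    · exact h1.trans h2
    · have e : (q₀ + L + 1) * M₁ = q₀ * M₁ + M₁ + L * M₁ := by ring
      rw [e]
      rw [Nat.mul_add, Nat.mul_one] at h3
      omega
  -- the two admissible values of `q`
  have hval : ∀ t ∈ (Finset.range Mk).filter fun t => ((L * (t / L) / M₁ : ℕ) : ZMod N) = r,
      L * (t / L) / M₁ = r.val ∨ L * (t / L) / M₁ = r.val + N := by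
    intro t ht
    rw [Finset.mem_filter, Finset.mem_range] at ht
    obtain ⟨htM, hr⟩ := ht
    have hqN : L * (t / L) / M₁ ≤ N := by
      calc L * (t / L) / M₁ ≤ t / M₁ := Nat.div_le_div_right (Nat.mul_div_le t L)
        _ ≤ Mk / M₁ := Nat.div_le_div_right htM.le
        _ ≤ N := hN
    have hmod : L * (t / L) / M₁ % N = r.val := by rw [← hr, ZMod.val_natCast]
    have hdiv : L * (t / L) / M₁ / N < 2 := (Nat.div_lt_iff_lt_mul (by omega)).2 (by omega)
    have hsplit := Nat.mod_add_div (L * (t / L) / M₁) N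
    rw [hmod] at hsplit
    rcases (Nat.lt_succ_iff.1 hdiv).eq_or_lt with h1 | h0
    · right
      rw [h1, Nat.mul_one] at hsplit
      exact hsplit.symm
    · left
      rw [Nat.lt_one_iff.1 h0, Nat.mul_zero, Nat.add_zero] at hsplit
      exact hsplit.symm
  -- hence the filter lies in the union of two intervals
  have hsub : ((Finset.range Mk).filter fun t => ((L * (t / L) / M₁ : ℕ) : ZMod N) = r) ⊆
      Finset.Ico (r.val * M₁) ((r.val + L + 1) * M₁) ∪ Finset.Ico ((r.val + N) * M₁) ((r.val + N + L + 1) * M₁) := by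
    intro t ht
    have htM : t ∈ Finset.range Mk := (Finset.mem_filter.1 ht).1
    rcases hval t ht with h0 | h1
    · exact Finset.mem_union_left _ (hfib r.val (Finset.mem_filter.2 ⟨htM, h0⟩))
    · exact Finset.mem_union_right _ (hfib (r.val + N) (Finset.mem_filter.2 ⟨htM, h1⟩))
  have hlen : ∀ q₀ : ℕ, (Finset.Ico (q₀ * M₁) ((q₀ + L + 1) * M₁)).card = (L + 1) * M₁ := by
    intro q₀
    rw [Nat.card_Ico]
    have e : (q₀ + L + 1) * M₁ = (L + 1) * M₁ + q₀ * M₁ := by ring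
    omega
  calc ((Finset.range Mk).filter fun t => ((L * (t / L) / M₁ : ℕ) : ZMod N) = r).card
      ≤ (Finset.Ico (r.val * M₁) ((r.val + L + 1) * M₁) ∪ Finset.Ico ((r.val + N) * M₁) ((r.val + N + L + 1) * M₁)).card :=
        Finset.card_le_card hsub
    _ ≤ (Finset.Ico (r.val * M₁) ((r.val + L + 1) * M₁)).card + (Finset.Ico ((r.val + N) * M₁) ((r.val + N + L + 1) * M₁)).card :=
        Finset.card_union_le _ _
    _ = 2 * ((L + 1) * M₁) := by rw [hlen, hlen]; ring

/-- **THE 3-D FIBRE COUNT**: at most `(2(L+1)M₁)³` box points carry a given label at their corner. [folklore] -/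
theorem card_fibre_le (hM₁ : 1 ≤ K₀.M₁) (b : Fin 3 → ZMod (nblkOf S K₀ k)) :
    ((pbox (sideT S k)).filter fun z => lab S k K₀ (B6Elimination.corner L z) = b).card ≤ (2 * ((L + 1) * K₀.M₁)) ^ 3 := by
  have hsub : ((pbox (sideT S k)).filter fun z => lab S k K₀ (B6Elimination.corner L z) = b) ⊆
      Fintype.piFinset fun μ =>
        ((Finset.range (S.P.sitesPerDir k)).filter fun t =>
          ((L * (t / L) / K₀.M₁ : ℕ) : ZMod (nblkOf S K₀ k)) = b μ).map Nat.castEmbedding := by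
    intro z hz
    rw [Finset.mem_filter] at hz
    obtain ⟨hzb, hzl⟩ := hz
    rw [Fintype.mem_piFinset]
    intro μ
    obtain ⟨h0, hlt⟩ := B6Lemma24Torus.mem_pbox.1 hzb μ
    rw [Finset.mem_map]
    refine ⟨(z μ).toNat, ?_, ?_⟩
    · rw [Finset.mem_filter, Finset.mem_range]
      refine ⟨?_, ?_⟩
      · change z μ < ((S.P.sitesPerDir k : ℕ) : ℤ) at hlt
        omega
      · have hμ := congrFun hzl μ
        change ((((L : ℤ) * (z μ / (L : ℤ))).toNat / K₀.M₁ : ℕ) : ZMod (nblkOf S K₀ k)) = b μ at hμ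
        rwa [toNat_corner_coord L h0] at hμ
    · exact Int.toNat_of_nonneg h0
  calc ((pbox (sideT S k)).filter fun z => lab S k K₀ (B6Elimination.corner L z) = b).card
      ≤ (Fintype.piFinset fun μ =>
          ((Finset.range (S.P.sitesPerDir k)).filter fun t =>
            ((L * (t / L) / K₀.M₁ : ℕ) : ZMod (nblkOf S K₀ k)) = b μ).map Nat.castEmbedding).card := Finset.card_le_card hsub
    _ = ∏ μ, (((Finset.range (S.P.sitesPerDir k)).filter fun t =>
            ((L * (t / L) / K₀.M₁ : ℕ) : ZMod (nblkOf S K₀ k)) = b μ).map Nat.castEmbedding).card := Fintype.card_piFinset _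
    _ ≤ ∏ _μ : Fin 3, 2 * ((L + 1) * K₀.M₁) :=
        Finset.prod_le_prod (fun _ _ => Nat.zero_le _) fun μ _ => by
          rw [Finset.card_map]
          exact card_filter_label_le L K₀.M₁ (S.P.sitesPerDir k) (nblkOf S K₀ k) (one_le_L S) hM₁ (le_max_right _ _) (b μ)
    _ = (2 * ((L + 1) * K₀.M₁)) ^ 3 := by rw [Finset.prod_const, Finset.card_univ, Fintype.card_fin]

/-- **THE BAD POINTS ARE PAID FOR BY THE MISSING BIG BLOCKS**: `#badPts ≤ (2(L+1)M₁)³ · #(big blocks ∖ ΩblkOf h)`. [folklore] -/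
theorem card_badPts_le (hM₁ : 1 ≤ K₀.M₁) :
    (badPts S k K₀ h).card ≤
      (2 * ((L + 1) * K₀.M₁)) ^ 3 * (Finset.univ \ ΩblkOf K₀.M₁ (rcolOf S K₀) (nblkOf S K₀ k) h).card := by
  refine Finset.card_le_mul_card_image_of_maps_to (f := fun z => lab S k K₀ (B6Elimination.corner L z))
    (fun z hz => Finset.mem_sdiff.2 ⟨Finset.mem_univ _, (Finset.mem_filter.1 hz).2⟩) _ fun b _ => ?_
  refine le_trans (Finset.card_le_card fun z hz => ?_) (card_fibre_le S k K₀ hM₁ b)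
  rw [Finset.mem_filter] at hz ⊢
  exact ⟨(Finset.mem_filter.1 hz.1).1, hz.2⟩

/-- … and the missing big blocks by `|Z_k(h)|` (✓`Carriers.card_compl_ΩblkOf_le_ZVol`): `#badPts ≤ (2(L+1)M₁)³·|Z_k(h)|`. [cite: Balaban1985UV3, (41) p.266 + p.270 L31] -/
theorem card_badPts_le_ZVol (hM₁ : 1 ≤ K₀.M₁) :
    ((badPts S k K₀ h).card : ℝ) ≤ (2 * ((L + 1) * K₀.M₁ : ℝ)) ^ 3 * (ZVol K₀.M₁ (rcolOf S K₀) (k + 1) h k : ℝ) := by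
  have h1 := card_badPts_le S k K₀ h hM₁
  have h2 := card_compl_ΩblkOf_le_ZVol K₀.M₁ (rcolOf S K₀) (nblkOf S K₀ k) h
  have h3 : (badPts S k K₀ h).card ≤ (2 * ((L + 1) * K₀.M₁)) ^ 3 * ZVol K₀.M₁ (rcolOf S K₀) (k + 1) h k :=
    h1.trans (Nat.mul_le_mul_left _ h2)
  exact_mod_cast h3

/-- **(G1) DISCHARGED**: `dimC h ≤ 9·(2(L+1)M₁)³·|Z_k(h)|`. [cite: Balaban1985UV3, (35) p.265] -/
theorem dimC_le_ZVol (hM₁ : 1 ≤ K₀.M₁) :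
    (dimC S k K₀ h : ℝ) ≤ 9 * (2 * ((L + 1) * K₀.M₁ : ℝ)) ^ 3 * (ZVol K₀.M₁ (rcolOf S K₀) (k + 1) h k : ℝ) := by
  have hinj : Fintype.card {f : ↥(freeT L (sideT S k)) // (f : B4.Idx (pbox (sideT S k)) 3) ∉ lamBonds S k K₀ h} ≤
      (badPts S k K₀ h).card * 3 := by
    have e : Fintype.card (↥(badPts S k K₀ h) × Fin 3) = (badPts S k K₀ h).card * 3 := by
      rw [Fintype.card_prod, Fintype.card_coe, Fintype.card_fin]
    rw [← e]
    refine Fintype.card_le_of_injective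
      (fun f => (⟨((f.1 : B4.Idx (pbox (sideT S k)) 3).1 : Fin 3 → ℤ),
        fst_mem_badPts_of_not_mem_lamBonds S k K₀ h f.1.2 f.2⟩, (f.1 : B4.Idx (pbox (sideT S k)) 3).2)) ?_
    intro f g hfg
    simp only [Prod.mk.injEq, Subtype.mk.injEq] at hfg
    exact Subtype.ext (Subtype.ext (Prod.ext (Subtype.ext hfg.1) hfg.2))
  have h1 : dimC S k K₀ h ≤ 9 * (badPts S k K₀ h).card := by rw [dimC_eq]; omega
  have h2 : (dimC S k K₀ h : ℝ) ≤ 9 * (badPts S k K₀ h).card := by exact_mod_cast h1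
  have h3 := card_badPts_le_ZVol S k K₀ h hM₁
  nlinarith

/-- The coarse bonds missing `Λ'₀(h)` number at most `3·#badPts`. [folklore] -/
theorem card_faces_sdiff_le :
    (faces L (sideT S k) \ facesOf L (sideT S k) (lamCoarse S k K₀ h)).card ≤ 3 * (badPts S k K₀ h).card := by
  calc (faces L (sideT S k) \ facesOf L (sideT S k) (lamCoarse S k K₀ h)).card
      ≤ (badPts S k K₀ h ×ˢ (Finset.univ : Finset (Fin 3))).card :=
        Finset.card_le_card fun c hc => by
          rw [Finset.mem_sdiff] at hc
          exact Finset.mem_product.2 ⟨fst_mem_badPts_of_face S k K₀ h hc.1 hc.2, Finset.mem_univ _⟩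
    _ = 3 * (badPts S k K₀ h).card := by rw [Finset.card_product, Finset.card_univ, Fintype.card_fin]; ring

/-- **(G2) DISCHARGED**: `|J1 h − JT| ≤ 27·log L·(2(L+1)M₁)³·|Z_k(h)|` (`JT − J1 h = 9 log L·#(faces ∖ facesOf Λ'₀(h))`). [cite: Balaban1985UV3, (35) p.265] -/
theorem abs_J1_sub_JT_le_ZVol (hM₁ : 1 ≤ K₀.M₁) :
    |J1 S k K₀ h - JT S k| ≤ 27 * Real.log L * (2 * ((L + 1) * K₀.M₁ : ℝ)) ^ 3 * (ZVol K₀.M₁ (rcolOf S K₀) (k + 1) h k : ℝ) := by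
  have hsub : facesOf L (sideT S k) (lamCoarse S k K₀ h) ⊆ faces L (sideT S k) := fun _ hc =>
    ((B6LowerBound2153Torus.mem_facesOf (sideT S k)).1 hc).1
  have hcard : ((faces L (sideT S k)).card : ℝ) - (facesOf L (sideT S k) (lamCoarse S k K₀ h)).card =
      ((faces L (sideT S k) \ facesOf L (sideT S k) (lamCoarse S k K₀ h)).card : ℝ) := by
    rw [Finset.card_sdiff_of_subset hsub, Nat.cast_sub (Finset.card_le_card hsub)]
  have hL : (1 : ℝ) ≤ L := by exact_mod_cast one_le_L S
  have hlog : 0 ≤ Real.log (L : ℝ) := Real.log_nonneg hL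
  have hdiff : J1 S k K₀ h - JT S k =
      -(9 * Real.log L * ((faces L (sideT S k) \ facesOf L (sideT S k) (lamCoarse S k K₀ h)).card : ℝ)) := by
    rw [← hcard]
    unfold J1 JT
    rw [Real.log_pow]
    push_cast
    ring
  have hn : ((faces L (sideT S k) \ facesOf L (sideT S k) (lamCoarse S k K₀ h)).card : ℝ) ≤ 3 * (badPts S k K₀ h).card := by
    exact_mod_cast card_faces_sdiff_le S k K₀ h
  have h3 := card_badPts_le_ZVol S k K₀ h hM₁
  rw [hdiff, abs_neg, abs_of_nonneg (by positivity)]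
  nlinarith

end Counts

/-! ## §5 Rows #12 and #13 CLOSED for the draft's fields (no residual hypothesis beyond the field identities) -/

section Closed

variable {L : ℕ} (k : ℕ) (𝔎 : LaneConsts L) {S : Scales L} {G : Type} [GaugeGroup G] [MeasurableSpace G] [HaarData G]
  {V : Type} [NormedAddCommGroup V] [NormedSpace ℂ V] (X : ExternalInputsAC S G)

/-- ★★ **ROW #12 CLOSED FOR THE DRAFT's FIELDS**: any expansion data `𝔖` whose (61)∕(62)-numbers at step `k` are the draft's (`hT`, `hZ` — `rfl` once B0 sets the six
fields) satisfies `Norm35StepAsCited (piecesAC 𝔎 X 𝔖 k) γ′₀ a cv cJ` with `cv = cvT L M₁`, `cJ = cJT L M₁` — (G1)(G2) discharged by §4. [cite: Balaban1985UV3, (35) p.265 + (61)–(63) pp.271–272] -/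
theorem norm35_row_of_fields' (hk : k < S.m + S.K) (𝔖 : ∀ j, StepSeries S G V (nblkOf S 𝔎.carrier j) j)
    (hT : (𝔖 k).JT + StepSeries.gaussLog (𝔖 k).QT = JT S k + StepSeries.gaussLog (QT S k))
    (hZ : ∀ hh : Hist S.P (k + 1),
      (𝔖 k).J1 hh + StepSeries.gaussLog ((𝔖 k).Q1 hh) = J1 S k 𝔎.carrier hh + StepSeries.gaussLog (Q1 S k 𝔎.carrier hh)) :
    Norm35StepAsCited (piecesAC 𝔎 X 𝔖 k) (gamma2153 3 L) (aT L) (cvT L 𝔎.carrier.M₁) (cJT L 𝔎.carrier.M₁) :=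
  norm35_row_of_fields k 𝔎 X hk 𝔖 hT hZ (fun hh => dimC_le_ZVol S k 𝔎.carrier hh 𝔎.F.M₁_pos)
    (fun hh => abs_J1_sub_JT_le_ZVol S k 𝔎.carrier hh 𝔎.F.M₁_pos)

/-- **`example` #12, NO residual hypothesis**: for `𝔖 := withTZ 𝔎.carrier 𝔖₀` row #12 holds outright. [cite: Balaban1985UV3, (35) p.265] -/
example (hk : k < S.m + S.K) (𝔖₀ : ∀ j, StepSeries S G V (nblkOf S 𝔎.carrier j) j) :
    Norm35StepAsCited (piecesAC 𝔎 X (withTZ (S := S) 𝔎.carrier 𝔖₀) k) (gamma2153 3 L) (aT L) (cvT L 𝔎.carrier.M₁) (cJT L 𝔎.carrier.M₁) :=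
  norm35_row_of_fields' k 𝔎 X hk (withTZ (S := S) 𝔎.carrier 𝔖₀) rfl (fun _ => rfl)

/-- **Both rows at once** for the full flat overwrite. [cite: Balaban1985UV3, (35) p.265 + (62) p.271] -/
example (hk : k < S.m + S.K) (𝔖₀ : ∀ j, StepSeries S G V (nblkOf S 𝔎.carrier j) j) :
    Norm35StepAsCited (piecesAC 𝔎 X (withTZ (S := S) 𝔎.carrier 𝔖₀) k) (gamma2153 3 L) (aT L) (cvT L 𝔎.carrier.M₁) (cJT L 𝔎.carrier.M₁) ∧
      LogZTExtensiveAsCited (piecesAC 𝔎 X (withTZ (S := S) 𝔎.carrier 𝔖₀) k) (gamma2153 3 L) (aT L) 9 (27 * Real.log L) :=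
  ⟨norm35_row_of_fields' k 𝔎 X hk (withTZ (S := S) 𝔎.carrier 𝔖₀) rfl (fun _ => rfl),
    logZT_row_of_fields k 𝔎 X hk (withTZ (S := S) 𝔎.carrier 𝔖₀) rfl⟩

end Closed

/-! ## §6 (G3) The identification: (62)∕(61)'s numbers ARE three times the logarithm of [B6] (2.155)'s evaluated left side at `J = 0` -/

section Identification

open Literature.MathematicalPhysics.QuantumFieldTheory.Balaban1983to89.Beta.GaussianIntegral (log_integral_exp_neg_half_quadForm)
open Literature.MathematicalPhysics.QuantumFieldTheory.Balaban1983to89.B6Jacobian2155Torus (Zred ZredS sandwich_posDef_deltaPol ZredLam_deltaPol)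

/-- A block-diagonal real matrix with positive definite blocks is positive definite. [folklore] -/
theorem posDef_blockDiagonal {ι o : Type} [Fintype ι] [DecidableEq ι] [Fintype o] [DecidableEq o] {N : o → Matrix ι ι ℝ}
    (h : ∀ k, (N k).PosDef) : (blockDiagonal N).PosDef := by
  refine Matrix.PosDef.of_dotProduct_mulVec_pos ?_ fun x hx => ?_
  · rw [Matrix.IsHermitian, Matrix.blockDiagonal_conjTranspose]
    exact congrArg _ (funext fun k => (h k).1)
  · have e : star x ⬝ᵥ (blockDiagonal N *ᵥ x) = ∑ k, star (fun i => x (i, k)) ⬝ᵥ (N k *ᵥ fun i => x (i, k)) := by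
      simp only [star_trivial, dotProduct, mulVec, Matrix.blockDiagonal_apply', Fintype.sum_prod_type, ite_mul, zero_mul,
        Finset.sum_ite_eq, Finset.mem_univ, if_true]
      exact Finset.sum_comm
    rw [e]
    obtain ⟨⟨i, k⟩, hik⟩ : ∃ p, x p ≠ 0 := by
      by_contra hcon
      push Not at hcon
      exact hx (funext hcon)
    have hk : (fun j => x (j, k)) ≠ 0 := fun h0 => hik (congrFun h0 i)
    exact Finset.sum_pos' (fun k' _ => (h k').posSemidef.dotProduct_mulVec_nonneg _) ⟨k, Finset.mem_univ _, (h k).dotProduct_mulVec_pos hk⟩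

variable {L : ℕ} (S : Scales L) (k : ℕ) (K₀ : CarrierConsts) (h : Hist S.P (k + 1))

/-- **(G3) THE IDENTIFICATION FOR `Z^{(k)}(T₁^{(k)}, 1)`**: `log ∫ e^{−½⟨v, QT v⟩} = 3 · log Z′^{(k)}` with `Z′^{(k)} = Zred L Mₖ (deltaPol Mₖ (L^k))` the UNEVALUATED
reduced Gaussian of [B6] (2.155) (one per colour; (F1) along `eT`, then `det (blockDiagonal) = ∏ det` and the closed form of both sides).
[cite: Balaban1984PropagatorsII, (2.155) p.250; Balaban1985UV3, (62)–(63) pp.271–272] -/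
theorem gaussLog_QT_eq (hk : k < S.m + S.K) :
    StepSeries.gaussLog (QT S k) = 3 * Real.log (Zred L (sideT S k) (deltaPol (sideT S k) (L ^ k))) := by
  have hS := sandwich_posDef_deltaPol (M := sideT S k) (by norm_num) (one_le_L S) (sideT_dvd S k hk) (L ^ k) (one_le_L_pow S k)
  unfold StepSeries.gaussLog QT Zred
  rw [integral_quadExp_reindex, log_integral_exp_neg_half_quadForm _ (posDef_blockDiagonal fun _ => hS),
    log_integral_exp_neg_half_quadForm _ hS, Matrix.det_blockDiagonal, Finset.prod_const, Finset.card_univ, Fintype.card_fin,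
    Real.log_pow, Fintype.card_prod, Fintype.card_fin]
  push_cast
  ring

/-- **(62) = 3 × log of (2.155)'s LEFT SIDE at `J = 0`**: `JT + log ∫ e^{−½⟨v, QT v⟩} = 3 · log ((L³)^{|Λ′|} · Z′^{(k)})` — the draft's `log Z^{(k)}(T₁^{(k)}, 1)` IS, colour by
colour, the constrained flat Gaussian of (2.152) on the whole unit torus, evaluated by ✓`eq_2155_deltaPol` (convention D1: no (22) `const`).
[cite: Balaban1984PropagatorsII, (2.152)–(2.155) pp.249–250; Balaban1985UV3, (62) p.271] -/
theorem logZT_draft_eq (hk : k < S.m + S.K) :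
    JT S k + StepSeries.gaussLog (QT S k) =
      3 * Real.log ((((L : ℝ) ^ 3) ^ (faces L (sideT S k)).card) * Zred L (sideT S k) (deltaPol (sideT S k) (L ^ k))) := by
  have hS := sandwich_posDef_deltaPol (M := sideT S k) (by norm_num) (one_le_L S) (sideT_dvd S k hk) (L ^ k) (one_le_L_pow S k)
  have hZ : 0 < Zred L (sideT S k) (deltaPol (sideT S k) (L ^ k)) := B6Jacobian2155Torus.Zred_pos hS
  have hL : (0 : ℝ) < (L : ℝ) ^ 3 := by have := one_le_L S; positivity
  rw [gaussLog_QT_eq S k hk, Real.log_mul (pow_ne_zero _ hL.ne') hZ.ne', Real.log_pow]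
  unfold JT
  ring

/-- **(G3) FOR `Z^{(k)}(B(Λ_{k+1}(h)), 1)`**: `log ∫ e^{−½⟨v, Q1 h v⟩} = 3 · log Z′_Λ` with `Z′_Λ = ZredS L Mₖ (lamFree …) _ (deltaPol Mₖ (L^k))` ([B6] (2.155) «or on a subset Λ»).
[cite: Balaban1984PropagatorsII, (2.155) p.250; Balaban1985UV3, (61) + (63) pp.271–272] -/
theorem gaussLog_Q1_eq (hk : k < S.m + S.K) :
    StepSeries.gaussLog (Q1 S k K₀ h) =
      3 * Real.log (ZredS L (sideT S k) (lamBonds S k K₀ h) (lamFree_subset _ _ _) (deltaPol (sideT S k) (L ^ k))) := by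
  obtain ⟨hS, hZ⟩ := ZredLam_deltaPol (M := sideT S k) (by norm_num) (one_le_L S) (sideT_dvd S k hk) (L ^ k) (one_le_L_pow S k)
    (lamCoarse S k K₀ h)
  rw [hZ]
  unfold StepSeries.gaussLog Q1
  rw [integral_quadExp_reindex, log_integral_exp_neg_half_quadForm _ (posDef_blockDiagonal fun _ => hS),
    Matrix.det_blockDiagonal, Finset.prod_const, Finset.card_univ, Fintype.card_fin, Real.log_pow, Fintype.card_prod,
    Fintype.card_fin, Fintype.card_coe]
  have h2π : 0 < Real.sqrt (2 * Real.pi) := Real.sqrt_pos.2 (by positivity)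
  have hdet := hS.det_pos
  rw [Real.log_div (pow_ne_zero _ h2π.ne') (Real.sqrt_pos.2 hdet).ne', Real.log_pow, Real.log_sqrt (by positivity),
    Real.log_sqrt hdet.le]
  push_cast
  ring

end Identification

/-! ## §7 The record's side conditions on the six constants (`Primitives.AlphaConsts`: `c35_pos`, `cv_nonneg`, `cJ35_nonneg`, `cT_pos`, `cn_nonneg`, `cJT_nonneg`) -/

section SideConditions

variable {L : ℕ}

/-- `c35 = cT := gamma2153 3 L > 0` (`AlphaConsts.c35_pos` ∕ `cT_pos`). [cite: Balaban1984PropagatorsII, (2.157) p.250] -/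
theorem gamma2153_three_pos (S : Scales L) : 0 < gamma2153 3 L := B6Cov2156Torus.gamma2153_pos (by norm_num) (one_le_L S)

/-- `0 ≤ cvT L M₁` (`AlphaConsts.cv_nonneg`). [folklore] -/
theorem cvT_nonneg (M₁ : ℕ) : 0 ≤ cvT L M₁ := by unfold cvT; positivity

/-- `0 ≤ cJT L M₁` (`AlphaConsts.cJ35_nonneg`; `log L ≥ 0`). [folklore] -/
theorem cJT_nonneg (S : Scales L) (M₁ : ℕ) : 0 ≤ cJT L M₁ := by
  have hL : (1 : ℝ) ≤ L := by exact_mod_cast one_le_L S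
  have := Real.log_nonneg hL
  unfold cJT; positivity

/-- `0 ≤ cn := 9` and `0 ≤ cJT := 27·log L` (`AlphaConsts.cn_nonneg` ∕ `cJT_nonneg`). [folklore] -/
theorem cn_cJ13_nonneg (S : Scales L) : (0 : ℝ) ≤ 9 ∧ 0 ≤ 27 * Real.log (L : ℝ) := by
  have hL : (1 : ℝ) ≤ L := by exact_mod_cast one_le_L S
  have := Real.log_nonneg hL
  exact ⟨by norm_num, by positivity⟩

end SideConditions

end Summit.QuantumFields.YangMills.Theorems.AlphaInputsT3ACFlatGaussian

end
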